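import Mathlib.Analysis.SpecialFunctions.Sqrt
import Literature.MathematicalPhysics.QuantumLattice.NMRChargeDistribution
import HarnessLib

/-!
# The Shastry–Mila–Rice planar ⁶³Cu hyperfine dictionary — shifts, form factors, T₁ anisotropy, AF
# resonance — as exact definitions, and the certified arithmetic behind REFVALS-2 §132 (cell
# hubbard-downfold): the YBCO and La-214 constant sets of Zha, Barzykin and Pines (1996)

In the single-component Shastry–Mila–Rice (SMR) description a planar ⁶³Cu nucleus couples to the on-site
electron spin through `A_c`, `A_ab` and to each of the four neighbouring Cu spins through `B`
[ZhaBarzykinPines1996SMRHyperfine, §2].  Everything NMR then reads is a fixed combination: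

* spin shifts `⁶³K_c ∝ (A_c + 4B)χ₀`, `⁶³K_ab ∝ (A_ab + 4B)χ₀` (`shiftC`, `shiftAB`);
* relaxation form factors `⁶³F_c(q) = [A_ab + 2B(cos q_x a + cos q_y a)]²`,
  `⁶³F_ab^eff(q) = [A_c + 2B(cos q_x a + cos q_y a)]²`, `⁶³F_ab = ½(⁶³F_c + ⁶³F_ab^eff)` — here as
  functions of the two cosines `cx, cy` (`smrFc`, `smrFabEff`, `smrFab`); at `q = 0` they are the squared
  shift combinations, at `Q = (π, π)` the squares of `A_ab − 4B` and `A_c − 4B` (`smrFc_zero`, `smrFc_Q`,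
  …), and `(A_ab − 4B)² = afHyperfineInPlane²` — the tree's zero-field internal-field combination of
  `NMRChargeDistribution.lean` §9 (`smrFc_Q_eq_afHyperfine_sq`);
* the commensurate T₁ anisotropy `⁶³R(Q) = ½[1 + ((A_c − 4B)/(A_ab − 4B))²]`
  [ZhaBarzykinPines1996SMRHyperfine, §2 (δ → 0 of their Eq. for ⁶³R)] (`anisotropyQ`,
  `anisotropyQ_eq_formFactors`);
* the antiferromagnetic-resonance constraint `μ_eff (4B − A_ab)` and Monien et al.'s core-polarisation
  line `A_ab = (−395 κ̂ + 142)` kOe/μ_B [ibid., §3] (`afCombination`, `bleaneyAab`).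

Certified rows (all inputs printed in [ZhaBarzykinPines1996SMRHyperfine, §3]; kOe/μ_B):
the MMP/MPT YBCO₇ set `(A_c, A_ab, B) = (−163, 34, 40.8)`: `A_c + 4B = 0.2`, `A_ab + 4B = 197.2`,
`4B − A_ab = 129.2`, `⁶³R(Q) ∈ (3.687, 3.688)` (constraint «3.7 ± 0.1»); the ZBP YBCO₇ revision
`203/4.721 ∈ (42.99, 43.00)`, `0.721·203/4.721 ∈ (31.00, 31.01)`, `(−172, 31, 43)` has `A_c + 4B = 0`,
YBCO₆ `B = (128.5 + 31)/4 = 39.875` («39.8»); `κ̂(A_ab = 31) = (142 − 31)/395 ∈ (0.2810, 0.2811)` («0.281»),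
`A_ab(0.316) = 17.18` («18»), `A_ab(0.32) = 15.6` («≥ 16»); the ZBP La₂CuO₄ set `(−185, 18, 36.1)`:
`4B − A_ab = 126.4` («127»), `⁶³R(Q) ∈ (3.895, 3.897)` («3.9»); LSCO `x = 0.15` `(−185, 18, 51)`:
`4B + A_ab = 222`, `(4B + A_c)/(4B + A_ab) = 19/222 ∈ (0.0855, 0.0856)` («8.6 %»), `222/189 ∈ (1.174,
1.175)` («17 % above»); AF resonance `0.62 × 128.5 = 79.67` («79.65 ± 0.05») and `78.78/0.62 ∈ (127.06,
127.07)` («127»); and from `⁶³R = 3.9` with `4B − A_ab = 127` alone, `|A_c − 4B| = 127·√6.8 ∈ (331.1,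
331.2)` so `A_ab − A_c ∈ (204.1, 204.2)` («203»).  No named fact; which constant set (or which
Hamiltonian — REFVALS-2 §132.3 records the two-component dissent) is right is not decided here.
-/

noncomputable section

namespace Literature.MathematicalPhysics.QuantumLattice.SMRHyperfine

open Literature.MathematicalPhysics.QuantumLattice

/-! ## §1 The dictionary -/

/-- `c`-axis spin-shift combination `A_c + 4B` [cite: ZhaBarzykinPines1996SMRHyperfine, §2 (⁶³K_c)]. -/
def shiftC (Ac B : ℝ) : ℝ := Ac + 4 * B

/-- In-plane spin-shift combination `A_ab + 4B` [cite: ZhaBarzykinPines1996SMRHyperfine, §2 (⁶³K_ab)]. -/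
def shiftAB (Aab B : ℝ) : ℝ := Aab + 4 * B

/-- The antiferromagnetic-resonance combination `4B − A_ab` multiplying `μ_eff`
[cite: ZhaBarzykinPines1996SMRHyperfine, §3]. -/
def afCombination (Aab B : ℝ) : ℝ := 4 * B - Aab

/-- `⁶³F_c(q) = [A_ab + 2B(cos q_x a + cos q_y a)]²` as a function of the two cosines
[cite: ZhaBarzykinPines1996SMRHyperfine, §2]. -/
def smrFc (Aab B cx cy : ℝ) : ℝ := (Aab + 2 * B * (cx + cy)) ^ 2

/-- `⁶³F_ab^eff(q) = [A_c + 2B(cos q_x a + cos q_y a)]²` [cite: ZhaBarzykinPines1996SMRHyperfine, §2]. -/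
def smrFabEff (Ac B cx cy : ℝ) : ℝ := (Ac + 2 * B * (cx + cy)) ^ 2

/-- `⁶³F_ab = ½(⁶³F_c + ⁶³F_ab^eff)` [cite: ZhaBarzykinPines1996SMRHyperfine, §2]. -/
def smrFab (Ac Aab B cx cy : ℝ) : ℝ := (smrFc Aab B cx cy + smrFabEff Ac B cx cy) / 2

/-- The commensurate (`Q = (π,π)`) T₁ anisotropy `⁶³R = ½[1 + ((A_c − 4B)/(A_ab − 4B))²]`
[cite: ZhaBarzykinPines1996SMRHyperfine, §2 (δ → 0)]. -/
def anisotropyQ (Ac Aab B : ℝ) : ℝ := (1 + ((Ac - 4 * B) / (Aab - 4 * B)) ^ 2) / 2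

/-- Monien et al.'s core-polarisation line for the in-plane on-site constant, `A_ab = −395 κ̂ + 142` kOe/μ_B
(at the spin–orbit ratio `γ = 0.0469`) [cite: ZhaBarzykinPines1996SMRHyperfine, §3]. -/
def bleaneyAab (κ : ℝ) : ℝ := -395 * κ + 142

/-- Unfolding lemma for `shiftC` [cite: ZhaBarzykinPines1996SMRHyperfine, §2]. -/
theorem shiftC_def (Ac B : ℝ) : shiftC Ac B = Ac + 4 * B := rfl

/-- Unfolding lemma for `shiftAB` [cite: ZhaBarzykinPines1996SMRHyperfine, §2]. -/
theorem shiftAB_def (Aab B : ℝ) : shiftAB Aab B = Aab + 4 * B := rfl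

/-- Unfolding lemma for `afCombination` [cite: ZhaBarzykinPines1996SMRHyperfine, §3]. -/
theorem afCombination_def (Aab B : ℝ) : afCombination Aab B = 4 * B - Aab := rfl

/-- Unfolding lemma for `smrFc` [cite: ZhaBarzykinPines1996SMRHyperfine, §2]. -/
theorem smrFc_def (Aab B cx cy : ℝ) : smrFc Aab B cx cy = (Aab + 2 * B * (cx + cy)) ^ 2 := rfl

/-- Unfolding lemma for `smrFabEff` [cite: ZhaBarzykinPines1996SMRHyperfine, §2]. -/
theorem smrFabEff_def (Ac B cx cy : ℝ) : smrFabEff Ac B cx cy = (Ac + 2 * B * (cx + cy)) ^ 2 := rfl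

/-- Unfolding lemma for `smrFab` [cite: ZhaBarzykinPines1996SMRHyperfine, §2]. -/
theorem smrFab_def (Ac Aab B cx cy : ℝ) :
    smrFab Ac Aab B cx cy = (smrFc Aab B cx cy + smrFabEff Ac B cx cy) / 2 := rfl

/-- Unfolding lemma for `anisotropyQ` [cite: ZhaBarzykinPines1996SMRHyperfine, §2]. -/
theorem anisotropyQ_def (Ac Aab B : ℝ) :
    anisotropyQ Ac Aab B = (1 + ((Ac - 4 * B) / (Aab - 4 * B)) ^ 2) / 2 := rfl

/-- Unfolding lemma for `bleaneyAab` [cite: ZhaBarzykinPines1996SMRHyperfine, §3]. -/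
theorem bleaneyAab_def (κ : ℝ) : bleaneyAab κ = -395 * κ + 142 := rfl

/-- At `q = 0` (`cos = 1, 1`) the `c`-axis form factor is the squared in-plane SHIFT combination
[cite: ZhaBarzykinPines1996SMRHyperfine, §2]. -/
theorem smrFc_zero (Aab B : ℝ) : smrFc Aab B 1 1 = shiftAB Aab B ^ 2 := by
  unfold smrFc shiftAB; ring

/-- At `Q = (π, π)` (`cos = −1, −1`) it is `(A_ab − 4B)²` [cite: ZhaBarzykinPines1996SMRHyperfine, §2–§3]. -/
theorem smrFc_Q (Aab B : ℝ) : smrFc Aab B (-1) (-1) = afCombination Aab B ^ 2 := by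
  unfold smrFc afCombination; ring

/-- … which is the square of `NMRChargeDistribution`'s internal-field combination `|A_ab − 4B|`
[cite: ZhaBarzykinPines1996SMRHyperfine, §3] [cite: NishiokaEtAl2022Pr247NQR, p. 5]. -/
theorem smrFc_Q_eq_afHyperfine_sq (Aab B : ℝ) :
    smrFc Aab B (-1) (-1) = afHyperfineInPlane Aab B ^ 2 := by
  rw [smrFc_Q]; unfold afCombination afHyperfineInPlane
  rw [sq_abs]; ring

/-- At `q = 0` / `Q` the effective in-plane form factor is `(A_c + 4B)²` / `(A_c − 4B)²`
[cite: ZhaBarzykinPines1996SMRHyperfine, §2]. -/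
theorem smrFabEff_zero_Q (Ac B : ℝ) :
    smrFabEff Ac B 1 1 = shiftC Ac B ^ 2 ∧ smrFabEff Ac B (-1) (-1) = (Ac - 4 * B) ^ 2 := by
  unfold smrFabEff shiftC; constructor <;> ring

/-- The commensurate anisotropy IS the form-factor ratio at `Q`: `⁶³R(Q) = F_ab(Q)/F_c(Q)`
(when `A_ab ≠ 4B`) [cite: ZhaBarzykinPines1996SMRHyperfine, §2]. -/
theorem anisotropyQ_eq_formFactors {Ac Aab B : ℝ} (h : Aab - 4 * B ≠ 0) :
    anisotropyQ Ac Aab B = smrFab Ac Aab B (-1) (-1) / smrFc Aab B (-1) (-1) := by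
  unfold anisotropyQ smrFab smrFc smrFabEff
  have h2 : (Aab + 2 * B * (-1 + -1)) = Aab - 4 * B := by ring
  have h3 : (Ac + 2 * B * (-1 + -1)) = Ac - 4 * B := by ring
  rw [h2, h3]
  have hsq : (Aab - 4 * B) ^ 2 ≠ 0 := pow_ne_zero 2 h
  field_simp

/-- With the YBCO shift constraint `A_c + 4B = 0` exactly, `A_c − 4B = −8B` and the anisotropy depends on
`A_ab/B` only: `⁶³R(Q) = ½[1 + 64B²/(A_ab − 4B)²]` [cite: ZhaBarzykinPines1996SMRHyperfine, §3]. -/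
theorem anisotropyQ_of_shiftC_zero {Ac Aab B : ℝ} (h : shiftC Ac B = 0) :
    anisotropyQ Ac Aab B = (1 + (8 * B) ^ 2 / (Aab - 4 * B) ^ 2) / 2 := by
  unfold shiftC at h
  unfold anisotropyQ
  have : Ac - 4 * B = -(8 * B) := by linarith
  rw [this, div_pow, neg_sq]

/-! ## §2 YBa₂Cu₃O₇ / YBa₂Cu₃O₆ rows -/

/-- The Monien–Pines–Takigawa / MMP commensurate set `(A_c, A_ab, B) = (−163, 34, 40.8)` kOe/μ_B
[cite: ZhaBarzykinPines1996SMRHyperfine, §3]: shift combinations, AF combination vs the resonance value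
`128.5`, and the anisotropy `⁶³R(Q) ∈ (3.687, 3.688)` against the printed constraint `3.7 ± 0.1`. -/
theorem mmp_rows :
    shiftC (-163) 40.8 = 0.2 ∧ shiftAB 34 40.8 = 197.2 ∧ afCombination 34 40.8 = 129.2 ∧
    ((129.2 : ℝ) - 128.5) / 128.5 < 0.006 ∧ (34 : ℝ) - (-163) = 197 ∧
    ((3.687 : ℝ) < anisotropyQ (-163) 34 40.8 ∧ anisotropyQ (-163) 34 40.8 < 3.688) ∧
    ((3.7 : ℝ) - 0.1 < anisotropyQ (-163) 34 40.8 ∧ anisotropyQ (-163) 34 40.8 < 3.7 + 0.1) ∧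
    smrFc 34 40.8 (-1) (-1) = 16692.64 ∧ smrFabEff (-163) 40.8 (-1) (-1) = 106406.44 := by
  refine ⟨by norm_num [shiftC], by norm_num [shiftAB], by norm_num [afCombination], by norm_num, by norm_num,
    ⟨by norm_num [anisotropyQ], by norm_num [anisotropyQ]⟩, ⟨by norm_num [anisotropyQ], by norm_num [anisotropyQ]⟩,
    by norm_num [smrFc], by norm_num [smrFabEff]⟩

/-- [cite: ZhaBarzykinPines1996SMRHyperfine, §3]: the incommensurate YBa₂Cu₃O₇ revision — `A_ab − A_c =
4.721B = 203 ⇒ B ∈ (42.99, 43.00)`, `A_ab = 0.721B ∈ (31.00, 31.01)`; the rounded set `(−172, 31, 43)` has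
`A_c + 4B = 0` exactly, `4B − A_ab = 141`, `4B + A_ab = 203`, commensurate `⁶³R(Q) ∈ (3.476, 3.477)` (their
3.7 carries the `cos δ`, `δ = 0.1` factor — not reproduced); YBa₂Cu₃O₆ from the AF resonance:
`B = (128.5 + 31)/4 = 39.875` (printed 39.8); core polarisation on the Bleaney line: `κ̂(31) ∈ (0.2810,
0.2811)` (printed 0.281). -/
theorem zbp_ybco_rows :
    ((42.99 : ℝ) < 203 / 4.721 ∧ (203 : ℝ) / 4.721 < 43.00) ∧
    ((31.00 : ℝ) < 0.721 * (203 / 4.721) ∧ (0.721 : ℝ) * (203 / 4.721) < 31.01) ∧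
    shiftC (-172) 43 = 0 ∧ afCombination 31 43 = 141 ∧ shiftAB 31 43 = 203 ∧
    ((3.476 : ℝ) < anisotropyQ (-172) 31 43 ∧ anisotropyQ (-172) 31 43 < 3.477) ∧
    ((128.5 : ℝ) + 31) / 4 = 39.875 ∧
    bleaneyAab ((142 - 31) / 395) = 31 ∧ ((0.2810 : ℝ) < (142 - 31) / 395 ∧ ((142 : ℝ) - 31) / 395 < 0.2811) := by
  refine ⟨⟨by norm_num, by norm_num⟩, ⟨by norm_num, by norm_num⟩, by norm_num [shiftC],
    by norm_num [afCombination], by norm_num [shiftAB], ⟨by norm_num [anisotropyQ], by norm_num [anisotropyQ]⟩,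
    by norm_num, by norm_num [bleaneyAab], ⟨by norm_num, by norm_num⟩⟩

/-! ## §3 La₂CuO₄ / La₂₋ₓSrₓCuO₄ rows -/

/-- [cite: ZhaBarzykinPines1996SMRHyperfine, §3]: the adopted La-214 constants `A_ab = 18` (`κ̂ = 0.316`:
`bleaneyAab 0.316 = 17.18`; `bleaneyAab 0.32 = 15.6`, their «A_ab ≥ 16» bound), `A_c = −185`, with
`B = 36.1` (La₂CuO₄), `37.8` (x 0.10), `51` (x 0.15): `4B − A_ab = 126.4` (AF resonance 127), parent
`⁶³R(Q) ∈ (3.895, 3.897)` (Imai's 3.9), `A_ab − A_c = 203`; at `x = 0.15`: `4B + A_ab = 222`,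
`(4B + A_c)/(4B + A_ab) = 19/222 ∈ (0.0855, 0.0856)` («8.6 %»), `222/189 ∈ (1.174, 1.175)` («17 % above»
Ishida's 189), `⁶³R(Q) ∈ (2.686, 2.687)`; the parent's `(A_c + 4B)/(A_ab + 4B) = −0.25`. -/
theorem zbp_la214_rows :
    bleaneyAab 0.316 = 17.18 ∧ bleaneyAab 0.32 = 15.6 ∧ (18 : ℝ) - (-185) = 203 ∧
    afCombination 18 36.1 = 126.4 ∧
    ((3.895 : ℝ) < anisotropyQ (-185) 18 36.1 ∧ anisotropyQ (-185) 18 36.1 < 3.897) ∧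
    shiftC (-185) 36.1 / shiftAB 18 36.1 = -0.25 ∧
    shiftAB 18 51 = 222 ∧ shiftC (-185) 51 = 19 ∧
    ((0.0855 : ℝ) < shiftC (-185) 51 / shiftAB 18 51 ∧ shiftC (-185) 51 / shiftAB 18 51 < 0.0856) ∧
    ((1.174 : ℝ) < 222 / 189 ∧ (222 : ℝ) / 189 < 1.175) ∧
    ((2.686 : ℝ) < anisotropyQ (-185) 18 51 ∧ anisotropyQ (-185) 18 51 < 2.687) ∧
    afCombination 18 37.8 = 133.2 := by
  refine ⟨by norm_num [bleaneyAab], by norm_num [bleaneyAab], by norm_num, by norm_num [afCombination],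
    ⟨by norm_num [anisotropyQ], by norm_num [anisotropyQ]⟩, by norm_num [shiftC, shiftAB],
    by norm_num [shiftAB], by norm_num [shiftC], ⟨by norm_num [shiftC, shiftAB], by norm_num [shiftC, shiftAB]⟩,
    ⟨by norm_num, by norm_num⟩, ⟨by norm_num [anisotropyQ], by norm_num [anisotropyQ]⟩,
    by norm_num [afCombination]⟩

/-- The antiferromagnetic-resonance products [cite: ZhaBarzykinPines1996SMRHyperfine, §3]:
`μ_eff(4B − A_ab) = 79.65 ± 0.05` kOe (YBa₂Cu₃O₆), `78.78` (La₂CuO₄) with `μ_eff = 0.62 μ_B`: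
`0.62 × 128.5 = 79.67` (inside `79.65 ± 0.05`) and `78.78/0.62 ∈ (127.06, 127.07)` (printed 127). -/
theorem afResonance_rows :
    (0.62 : ℝ) * 128.5 = 79.67 ∧ ((79.65 : ℝ) - 0.05 ≤ 79.67 ∧ (79.67 : ℝ) ≤ 79.65 + 0.05) ∧
    ((127.06 : ℝ) < 78.78 / 0.62 ∧ (78.78 : ℝ) / 0.62 < 127.07) := by
  refine ⟨by norm_num, ⟨by norm_num, by norm_num⟩, ⟨by norm_num, by norm_num⟩⟩

/-- From `⁶³R(Q) = 3.9` and `4B − A_ab = 127` alone [cite: ZhaBarzykinPines1996SMRHyperfine, §3]: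
`(A_c − 4B)² = (2R − 1)(A_ab − 4B)²`, so `|A_c − 4B| = 127√6.8 ∈ (331.1, 331.2)` and, with `A_c < 4B`,
`A_ab − A_c = 127√6.8 − 127 ∈ (204.1, 204.2)` kOe/μ_B — the printed «A_ab − A_c = 203». -/
theorem la2cuo4_from_R :
    (2 * (3.9 : ℝ) - 1 = 6.8) ∧
    ((331.1 : ℝ) < 127 * Real.sqrt 6.8 ∧ 127 * Real.sqrt 6.8 < 331.2) ∧
    ((204.1 : ℝ) < 127 * Real.sqrt 6.8 - 127 ∧ 127 * Real.sqrt 6.8 - 127 < 204.2) ∧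
    (∀ Ac Aab B : ℝ, Aab - 4 * B ≠ 0 → Ac - 4 * B = -((Aab - 4 * B) * Real.sqrt 6.8) →
      anisotropyQ Ac Aab B = 3.9) := by
  have hs : (2.6076 : ℝ) < Real.sqrt 6.8 ∧ Real.sqrt 6.8 < 2.6077 := by
    constructor
    · rw [Real.lt_sqrt (by norm_num)]; norm_num
    · rw [Real.sqrt_lt' (by norm_num)]; norm_num
  have hsq : Real.sqrt 6.8 ^ 2 = 6.8 := Real.sq_sqrt (by norm_num)
  refine ⟨by norm_num, ⟨by linarith [hs.1], by linarith [hs.2]⟩, ⟨by linarith [hs.1], by linarith [hs.2]⟩, ?_⟩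
  intro Ac Aab B h hAc
  unfold anisotropyQ
  rw [hAc, neg_div, mul_div_cancel_left₀ _ h, neg_sq, hsq]
  norm_num

end Literature.MathematicalPhysics.QuantumLattice.SMRHyperfine

end
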